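import Summits.BirchSwinnertonDyer.BirchSwinnertonDyer.Theorems.AlignedTransportAtTwoMainConjectureOfRankZeroBSDAtTwoFineRoadInfResRel
import Summits.BirchSwinnertonDyer.BirchSwinnertonDyer.Theorems.ByReductionTypeAtTwoMultTransportKlein
import Summits.BirchSwinnertonDyer.Rank1Residual.X5.RationalTwoTorsionPoints
import Literature.NumberTheory.EllipticCurves.MazurTorsionGaloisStructureProofs
import Mathlib.NumberTheory.Padics.Hensel
import Mathlib.RingTheory.Polynomial.Cyclotomic.Roots
import HarnessLib

/-!
# `E(ℚ(ζ_{2^∞}))[2^∞] = 0` for every elliptic `E/ℚ` without a rational point of order `2` — Ribet's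
# hypothesis of the descent step (ε) DISCHARGED on the seed cell of crux C2, so the kernel of
# `Sel^{(rel)}(E/ℚ_∞) → Sel(E/ℚ(ζ_{2^∞}))` is finite UNCONDITIONALLY there

Cell `bsd-f1-sign2`, WIDTH-5 attach seat `bsd-line-att-p4` (gen 3) on line `birth` of crux C2
stmt-BirchSwinnertonDyer-22298 `MainConjectureOfRankZeroBSDAtTwo`; a `--supports 22298 --as helper` file.
HONEST FRAMING: THEOREMS ONLY — no definition, no named fact, no `sorry`; BSD is NOT proved by any of this.

WHY. The descent bricks of road (b″) (`…FineRoadInfRes` §2, att-p4 g2) bound the kernel of the restriction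
`H¹(ℚ_∞, E[2^∞]) → H¹(ℚ(ζ_{2^∞}), E[2^∞])` MODULO the named fact `Ribet1981.thm1_finite_primaryTorsion_cyclotomic`
(`E(K(μ_{p^∞}))[p^∞]` finite). On the seed cell (no rational `2`-torsion) the `p = 2`, `K = ℚ` instance is
ELEMENTARY and much stronger: `E(ℚ(ζ_{2^∞}))[2^∞] = 0`. Proof: a non-zero fixed point gives a non-zero `P ∈ E[2]`
fixed by `H' = ker χ₂ = Gal(ℚ̄/ℚ(ζ_{2^∞}))`. If `P` is the ONLY such point it is `Γ_ℚ`-fixed (`H'` is normal) —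
a rational `2`-torsion point. Otherwise `H'` fixes `E[2]` pointwise and `Γ_ℚ` acts through `Γ_ℚ/H' ≅ ℤ₂ˣ`
(`χ₂` onto, tree `GaloisRep.cyclotomicCharacter_surjective`), in which every element is a CUBE (Hensel: `X³ − u`
has a root for every `2`-adic unit `u`); a cube of a permutation of the three points of `E[2] ∖ 0` is an
involution or trivial, and a group of involutions of three points has a common fixed point — again a rational
`2`-torsion point. (Equivalently: `ℚ(P)` is a cubic field and `[ℚ(ζ_{2ⁿ}) : ℚ]` is a power of `2`.)

* §1 `exists_pow_three_eq_of_isUnit_two` — every unit of `ℤ₂` is a cube (Hensel's lemma).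
* §2 `pow_six_smul` — a Galois automorphism acts on `E[2] = {0, P, Q, P + Q}` (t42's `klein_cases`) with `σ⁶ = 1`.
* §3 **`fixedPoints_kerCyclotomicCharacter_geomPrimaryTorsion_eq_bot`**: for `W/ℚ` elliptic with no rational point of
  order `2`, `(E[2^∞])^{ker χ₂} = 0`; **`finite_fixedPoints_kerCyclotomicCharacter_two`** (Ribet's instance);
  **`finite_ker_res_kerCyclotomicCharacter_two`** / **`finite_ker_res_selmerInfty_two`**: the (ε)-kernels of
  `…FineRoadInfRes` §2 WITHOUT the Ribet hypothesis, for every `ℤ₂`-extension... (cyclotomic `κ`).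

References: K. Ribet, appendix to Katz–Lang, Enseign. Math. 27 (1981) Thm. 1; H. Imai, Proc. Japan Acad. 51 (1975);
R. Greenberg, LNM 1716 (1999) §3 Lemma 3.1; J.-P. Serre, *Abelian ℓ-adic representations* I §1.2; J. H. Silverman,
*AEC* III.6.4, VIII.1.
-/

set_option autoImplicit false
-- the Theorems namespace of this sub repeats the summit name by design (D-0017 nested layout)
set_option linter.dupNamespace false

noncomputable section

open scoped Classical

namespace Summit.BirchSwinnertonDyer.BirchSwinnertonDyer.Theorems.AlignedTransportAtTwoFineRoad.CycTorsion

open WeierstrassCurve Field Literature.NumberTheory.EllipticCurves Literature.NumberTheory.GaloisRepresentations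
  Literature.NumberTheory.EllipticCurves.Greenberg1999 Polynomial
  Summit.BirchSwinnertonDyer.BirchSwinnertonDyer.Theorems.MultTransportAtTwo

/-! ## §1 Every `2`-adic unit is a cube -/

/-- **Every unit of `ℤ₂` is a cube** (Hensel's lemma for `X³ − u` at `a = 1`: `‖1 − u‖ < 1 = ‖3‖²`).
[folklore] -/
theorem exists_pow_three_eq_of_isUnit_two {u : ℤ_[2]} (hu : IsUnit u) : ∃ z : ℤ_[2], z ^ 3 = u := by
  set F : ℤ_[2][X] := X ^ 3 - C u with hF
  have hFa : ∀ z : ℤ_[2], F.aeval z = z ^ 3 - u := fun z ↦ by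
    simp [hF, map_sub, aeval_X_pow, aeval_C]
  have hF' : F.derivative.aeval (1 : ℤ_[2]) = 3 := by
    have hd : F.derivative = C (3 : ℤ_[2]) * X ^ 2 := by
      rw [hF, derivative_sub, derivative_C, sub_zero, derivative_X_pow]
      norm_num
    rw [hd, map_mul, aeval_C, aeval_X_pow, one_pow, mul_one]
    rfl
  -- `‖1 - u‖ < 1`: every unit of `ℤ₂` reduces to `1` in `𝔽₂`
  have h1u : ‖F.aeval (1 : ℤ_[2])‖ < 1 := by
    rw [hFa, one_pow]
    have hred : PadicInt.toZMod (1 - u) = 0 := by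
      have hunit : IsUnit (PadicInt.toZMod u) := hu.map _
      have h01 : ∀ x : ZMod 2, x = 0 ∨ x = 1 := by decide
      rcases h01 (PadicInt.toZMod u) with h0 | h1
      · exact absurd h0 hunit.ne_zero
      · rw [map_sub, map_one, h1, sub_self]
    have hmem : (1 - u) ∈ RingHom.ker (PadicInt.toZMod : ℤ_[2] →+* ZMod 2) := hred
    rw [PadicInt.ker_toZMod, IsLocalRing.mem_maximalIdeal, mem_nonunits_iff, PadicInt.not_isUnit_iff] at hmem
    exact hmem
  have h3 : ‖F.derivative.aeval (1 : ℤ_[2])‖ = 1 := by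
    rw [hF', show (3 : ℤ_[2]) = ((3 : ℕ) : ℤ_[2]) by norm_cast, PadicInt.norm_natCast_eq_one_iff]
    decide
  have hnorm : ‖F.aeval (1 : ℤ_[2])‖ < ‖F.derivative.aeval (1 : ℤ_[2])‖ ^ 2 := by
    rw [h3, one_pow]; exact h1u
  obtain ⟨z, hz, -⟩ := hensels_lemma hnorm
  exact ⟨z, sub_eq_zero.1 (by rw [← hFa]; exact hz)⟩

/-! ## §2 `σ⁶ = 1` on the `𝔽₂`-plane `E[2] = {0, P, Q, P + Q}` -/

section TwoTorsion

variable (W : WeierstrassCurve ℚ) [W.IsElliptic]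

/-- **A Galois automorphism acts on `E[2]` with `σ⁶ = 1`** (it permutes the three non-zero points).
[cite: SilvermanAEC2009, III.§7] -/
theorem pow_six_smul (σ : absoluteGaloisGroup ℚ) (v : W.geomTorsion 2) : σ ^ 6 • v = v := by
  by_cases hv : v = 0
  · rw [hv, smul_zero]
  have hne : ∀ (τ : absoluteGaloisGroup ℚ) (w : W.geomTorsion 2), w ≠ 0 → τ • w ≠ 0 :=
    fun τ w hw h ↦ hw (by rw [← inv_smul_smul τ w, h, smul_zero])
  set w := σ • v with hw
  by_cases hvw : w = v
  · -- `σ` fixes `v`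
    have h1 : ∀ n : ℕ, σ ^ n • v = v := by
      intro n
      induction n with
      | zero => rw [pow_zero, one_smul]
      | succ n ih => rw [pow_succ, mul_smul, ← hw, hvw, ih]
    exact h1 6
  have hw0 : w ≠ 0 := hne σ v hv
  rcases klein_cases (WeierstrassCurve.natCard_geomTorsion_two W) (add_self_geomTorsion_two W) hv hw0 (Ne.symm hvw) (σ • w)
    with h | h | h | h
  · exact absurd h (hne σ w hw0)
  · -- `σ² v = v`
    have h2 : σ ^ 2 • v = v := by rw [pow_two, mul_smul, ← hw, h]
    calc σ ^ 6 • v = (σ ^ 2 * σ ^ 2 * σ ^ 2) • v := by rw [← pow_add, ← pow_add]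
      _ = v := by rw [mul_smul, mul_smul, h2, h2, h2]
  · exact absurd (smul_left_cancel σ (h.trans hw)) hvw
  · -- `σ³ v = v`
    have h3 : σ ^ 3 • v = v := by
      have e1 : σ ^ 3 • v = σ • (σ • (σ • v)) := by
        rw [show (3 : ℕ) = 1 + 1 + 1 from rfl, pow_succ, pow_succ, pow_one, mul_smul, mul_smul]
      rw [e1, ← hw, h, smul_add, ← hw, h, add_comm v w, ← add_assoc, add_self_geomTorsion_two, zero_add]
    calc σ ^ 6 • v = (σ ^ 3 * σ ^ 3) • v := by rw [← pow_add]
      _ = v := by rw [mul_smul, h3, h3]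

end TwoTorsion

/-! ## §3 `E(ℚ(ζ_{2^∞}))[2^∞] = 0` without a rational `2`-torsion point -/

section Main

variable (W : WeierstrassCurve ℚ) [W.IsElliptic]

omit [W.IsElliptic] in
/-- **Every element of `Γ_ℚ` is a cube modulo `ker χ₂`**: `g = g'³ · h` with `χ₂(h) = 1` (`χ₂ : Γ_ℚ ↠ ℤ₂ˣ` is onto
— tree `GaloisRep.cyclotomicCharacter_surjective` with the irreducibility of the cyclotomic polynomials over
`ℚ` — and every `2`-adic unit is a cube, §1). [cite: Washington1997, Ch. 14 p. 321 (χ onto)] -/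
theorem exists_eq_pow_three_mul_mem_ker (g : absoluteGaloisGroup ℚ) :
    ∃ g' h : absoluteGaloisGroup ℚ,
      h ∈ (GaloisRep.cyclotomicCharacter ℚ 2).toMonoidHom.ker ∧ g = g' ^ 3 * h := by
  set χ := GaloisRep.cyclotomicCharacter ℚ 2 with hχ
  obtain ⟨z, hz⟩ := exists_pow_three_eq_of_isUnit_two (u := ((χ g : ℤ_[2]ˣ) : ℤ_[2])) (Units.isUnit _)
  have hzunit : IsUnit z := (isUnit_pow_iff (by norm_num : (3 : ℕ) ≠ 0)).1 (hz ▸ Units.isUnit _)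
  have hirr : ∀ n : ℕ, 0 < n → Irreducible (Polynomial.cyclotomic n ℚ) :=
    fun n hn ↦ Polynomial.cyclotomic.irreducible_rat hn
  obtain ⟨g', hg'⟩ := GaloisRep.cyclotomicCharacter_surjective ℚ 2 hirr hzunit.unit
  refine ⟨g', (g' ^ 3)⁻¹ * g, ?_, by rw [mul_inv_cancel_left]⟩
  have h3 : χ g' ^ 3 = χ g := by
    apply Units.ext
    rw [Units.val_pow_eq_pow_val, hg', IsUnit.unit_spec, hz]
  rw [MonoidHom.mem_ker, map_mul, map_inv, map_pow]
  change ((χ g') ^ 3)⁻¹ * χ g = 1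
  rw [h3, inv_mul_cancel]

/-- **If `ker χ₂` fixes `E[2]` pointwise, every `g ∈ Γ_ℚ` acts on `E[2]` as an involution**: `g ≡ g'³`
modulo `ker χ₂` and `g'⁶ = 1` on `E[2]` (§2). [cite: SilvermanAEC2009, III.§7] -/
theorem smul_smul_eq_self_of_ker_fixes
    (htriv : ∀ h ∈ (GaloisRep.cyclotomicCharacter ℚ 2).toMonoidHom.ker, ∀ v : W.geomTorsion 2, h • v = v)
    (g : absoluteGaloisGroup ℚ) (v : W.geomTorsion 2) : g • (g • v) = v := by
  obtain ⟨g', h, hh, rfl⟩ := exists_eq_pow_three_mul_mem_ker g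
  rw [mul_smul, htriv h hh, mul_smul, htriv h hh, smul_smul, ← pow_add]
  exact pow_six_smul W g' v

/-- **No non-zero point of `E[2]` is fixed by `ker χ₂ = Gal(ℚ̄/ℚ(ζ_{2^∞}))`** when `E(ℚ)` has no point of
order `2`. If `P ≠ 0` were fixed: either `P` is the only such point — then it is `Γ_ℚ`-fixed (`ker χ₂` is
normal), a rational `2`-torsion point (`not_hasIrreducibleModPGaloisRep_of_smul_eq` against
`irr_two_of_forall_not_hasRationalTwoTorsionX`); or `ker χ₂` fixes `E[2]` pointwise — then every `g ∈ Γ_ℚ` is an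
involution on `E[2]` (cubes), and involutions `g₁` moving `P` and `g₂` moving the `g₁`-fixed point `P + g₁P`
compose to an element of order `3`: contradiction. («`ℚ(P)` is cubic, `ℚ(ζ_{2ⁿ})/ℚ` has `2`-power degree.»)
[cite: SilvermanAEC2009, III.§7 and VIII.1] -/
theorem not_exists_twoTorsion_fixed_kerCyclotomicCharacter (ht : ∀ x : ℚ, ¬ HasRationalTwoTorsionX W x) :
    ¬ ∃ P : W.geomTorsion 2, P ≠ 0 ∧
      ∀ h ∈ (GaloisRep.cyclotomicCharacter ℚ 2).toMonoidHom.ker, h • P = P := by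
  set H' := (GaloisRep.cyclotomicCharacter ℚ 2).toMonoidHom.ker with hH'
  rintro ⟨P, hP0, hPfix⟩
  -- no rational point of order `2` ⇒ `E[2]` irreducible (as in `…Closure.irr_two_of_forall_not_hasRationalTwoTorsionX`)
  have hirr : W.HasIrreducibleModPGaloisRep 2 := by
    refine (Summit.BirchSwinnertonDyer.Rank1Residual.X5.O1.irr_two_iff_forall_two_nsmul W).mpr fun T h2T ↦ ?_
    rcases T with _ | ⟨x, y, h⟩
    · rfl
    · exfalso
      refine ht x ⟨y, ((Affine.nonsingular_iff' x y).mp h).1, ?_⟩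
      have hneg : (Affine.Point.some x y h : W.toAffine.Point) = -(Affine.Point.some x y h) := by
        rw [← add_eq_zero_iff_eq_neg, ← two_nsmul]; exact h2T
      rw [Affine.Point.neg_some, Affine.Point.some.injEq] at hneg
      have hy : y = -y - W.a₁ * x - W.a₃ := hneg.2
      linear_combination hy
  -- no non-zero point of `E[2]` is `Γ_ℚ`-fixed
  have hnofix : ∀ v : W.geomTorsion 2, v ≠ 0 → ∃ g : absoluteGaloisGroup ℚ, g • v ≠ v := by
    intro v hv
    by_contra hall
    push Not at hall
    exact not_hasIrreducibleModPGaloisRep_of_smul_eq W 2 hv hall hirr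
  have hne : ∀ (τ : absoluteGaloisGroup ℚ) (w : W.geomTorsion 2), w ≠ 0 → τ • w ≠ 0 :=
    fun τ w hw h ↦ hw (by rw [← inv_smul_smul τ w, h, smul_zero])
  -- every `Γ_ℚ`-translate of `P` is again a non-zero `H'`-fixed point (`H'` is normal)
  have htrans : ∀ g : absoluteGaloisGroup ℚ, ∀ h ∈ H', h • (g • P) = g • P := by
    intro g h hh
    have hconj : g⁻¹ * h * g ∈ H' := (MonoidHom.normal_ker _).conj_mem' h hh g
    calc h • (g • P) = g • ((g⁻¹ * h * g) • P) := by
          rw [mul_smul, mul_smul, smul_inv_smul]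
      _ = g • P := by rw [hPfix _ hconj]
  by_cases hB : ∀ Q : W.geomTorsion 2, Q ≠ 0 → (∀ h ∈ H', h • Q = Q) → Q = P
  · -- `P` is the only fixed point: it is rational
    obtain ⟨g, hg⟩ := hnofix P hP0
    exact hg (hB (g • P) (hne g P hP0) (htrans g))
  -- a second fixed point `Q`: `H'` fixes all of `E[2]`
  push Not at hB
  obtain ⟨Q, hQ0, hQfix, hQP⟩ := hB
  have htriv : ∀ h ∈ H', ∀ v : W.geomTorsion 2, h • v = v := by
    intro h hh v
    rcases klein_cases (WeierstrassCurve.natCard_geomTorsion_two W) (add_self_geomTorsion_two W) hP0 hQ0 (Ne.symm hQP) v with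
      rfl | rfl | rfl | rfl
    · exact smul_zero h
    · exact hPfix h hh
    · exact hQfix h hh
    · rw [smul_add, hPfix h hh, hQfix h hh]
  have hinv : ∀ (g : absoluteGaloisGroup ℚ) (v : W.geomTorsion 2), g • (g • v) = v :=
    smul_smul_eq_self_of_ker_fixes W htriv
  -- `g₁` moves `P`; it fixes `R = P + g₁ • P`
  obtain ⟨g₁, hg₁⟩ := hnofix P hP0
  set Q₁ := g₁ • P with hQ₁
  have hQ₁0 : Q₁ ≠ 0 := hne g₁ P hP0
  have hg₁Q₁ : g₁ • Q₁ = P := by rw [hQ₁, hinv]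
  set R := P + Q₁ with hR
  have hnegQ₁ : -Q₁ = Q₁ := neg_eq_iff_add_eq_zero.2 (add_self_geomTorsion_two W Q₁)
  have hR0 : R ≠ 0 := fun h ↦ hg₁ (by
    rw [hR, add_eq_zero_iff_eq_neg, hnegQ₁] at h
    exact h.symm)
  have hRP : R ≠ P := fun h ↦ hQ₁0 (by simpa [hR] using h)
  have hg₁R : g₁ • R = R := by rw [hR, smul_add, hg₁Q₁, ← hQ₁, add_comm]
  have hQ₁R : Q₁ = R + P := by
    rw [hR, add_comm P Q₁, add_assoc, add_self_geomTorsion_two, add_zero]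
  have hPR : P = R + Q₁ := by
    rw [hR, add_assoc, add_self_geomTorsion_two, add_zero]
  -- `g₂` moves `R`, to `P` or to `Q₁`
  obtain ⟨g₂, hg₂⟩ := hnofix R hR0
  rcases klein_cases (WeierstrassCurve.natCard_geomTorsion_two W) (add_self_geomTorsion_two W) hP0 hQ₁0 (Ne.symm hg₁) (g₂ • R)
    with h | h | h | h
  · exact hne g₂ R hR0 h
  · -- `g₂ • R = P`: then `g₁ g₂` has order `3`
    have hg₂P : g₂ • P = R := by rw [← h, hinv]
    have hg₂Q₁ : g₂ • Q₁ = Q₁ := by rw [hQ₁R, smul_add, h, hg₂P, add_comm]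
    have h3 : (g₁ * g₂) • R = Q₁ := by rw [mul_smul, h, hQ₁]
    have h3' : (g₁ * g₂) • Q₁ = P := by rw [mul_smul, hg₂Q₁, hg₁Q₁]
    have := hinv (g₁ * g₂) R
    rw [h3, h3'] at this
    exact hRP this.symm
  · -- `g₂ • R = Q₁`: then `g₂ g₁` has order `3`
    have hg₂Q₁ : g₂ • Q₁ = R := by rw [← h, hinv]
    have hg₂P : g₂ • P = P := by rw [hPR, smul_add, h, hg₂Q₁, add_comm]
    have h3 : (g₂ * g₁) • P = R := by rw [mul_smul, ← hQ₁, hg₂Q₁]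
    have h3' : (g₂ * g₁) • R = Q₁ := by rw [mul_smul, hg₁R, h]
    have := hinv (g₂ * g₁) P
    rw [h3, h3'] at this
    exact (Ne.symm hg₁) this.symm  -- Q₁ ≠ P
  · exact hg₂ h

/-- **`E(ℚ(ζ_{2^∞}))[2^∞] = 0`**: for an elliptic curve `E/ℚ` with no rational point of order `2`, NO non-zero
`2`-power torsion point of `E(ℚ̄)` is fixed by `ker χ₂ = Gal(ℚ̄/ℚ(ζ_{2^∞}))`. (A fixed point `m ≠ 0` of order `2ᵏ`
gives the fixed point `2^{k-1} m ∈ E[2] ∖ 0`, excluded above.) This is the `K = ℚ`, `p = 2` instance of Ribet's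
theorem (`Ribet1981.thm1_finite_primaryTorsion_cyclotomic`: finiteness) in the strong form `= 0`, for the curves
of the seed cell of crux C2. [cite: Ribet1981CyclotomicTorsion, Thm. 1 and Thm. 3, pp. 315–316]
[cite: SilvermanAEC2009, III.§7 and VIII.1] -/
theorem fixedPoints_kerCyclotomicCharacter_geomPrimaryTorsion_eq_bot (ht : ∀ x : ℚ, ¬ HasRationalTwoTorsionX W x) :
    FixedPoints.addSubgroup (GaloisRep.cyclotomicCharacter ℚ 2).toMonoidHom.ker (W.geomPrimaryTorsion 2) = ⊥ := by
  set H' := (GaloisRep.cyclotomicCharacter ℚ 2).toMonoidHom.ker with hH'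
  rw [eq_bot_iff]
  intro m hm
  rw [AddSubgroup.mem_bot]
  by_contra hm0
  have hmfix : ∀ h ∈ H', h • m = m := fun h hh ↦ (FixedPoints.mem_addSubgroup _ _ _).1 hm ⟨h, hh⟩
  -- the order of `m` is `2 ^ n₀` with `n₀ ≥ 1`
  have hex : ∃ n : ℕ, 2 ^ n • (m : W.geomPoints) = 0 := (AddCommGroup.mem_primaryComponent).1 m.2
  set n₀ := Nat.find hex with hn₀
  have hn₀spec : 2 ^ n₀ • (m : W.geomPoints) = 0 := Nat.find_spec hex
  have hn₀pos : n₀ ≠ 0 := by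
    intro h0
    rw [h0, pow_zero, one_smul] at hn₀spec
    exact hm0 (Subtype.ext hn₀spec)
  obtain ⟨k, hk⟩ := Nat.exists_eq_add_one_of_ne_zero hn₀pos
  -- `P = 2^k • m` is a non-zero `2`-torsion point fixed by `H'`
  set P₀ : W.geomPoints := 2 ^ k • (m : W.geomPoints) with hP₀
  have hP₀ne : P₀ ≠ 0 := by
    intro h
    have := Nat.find_min hex (show k < n₀ by rw [hk]; exact Nat.lt_succ_self k)
    exact this h
  have hP₀2 : (2 : ℕ) • P₀ = 0 := by
    rw [hP₀, smul_smul, ← pow_succ', ← hk]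
    exact hn₀spec
  have hP₀mem : P₀ ∈ W.geomTorsion 2 := AddSubgroup.torsionBy.nsmul_iff.2 hP₀2
  refine not_exists_twoTorsion_fixed_kerCyclotomicCharacter W ht ⟨⟨P₀, hP₀mem⟩, ?_, fun h hh ↦ ?_⟩
  · exact fun h ↦ hP₀ne (congrArg Subtype.val h)
  · apply Subtype.ext
    rw [AddSubgroup.torsionBy.coe_smul]
    change h • P₀ = P₀
    rw [hP₀, smul_comm, ← Literature.NumberTheory.EllipticCurves.primaryComponent.coe_smul, hmfix h hh]

/-- **Ribet's hypothesis, DISCHARGED for these curves**: `(E[2^∞])^{ker χ₂}` is finite (indeed trivial) for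
every elliptic `E/ℚ` without a rational point of order `2` — the `(K, W, p) = (ℚ, W, 2)` instance of
`Ribet1981.thm1_finite_primaryTorsion_cyclotomic` used by `…FineRoadInfRes` §2.
[cite: Ribet1981CyclotomicTorsion, Thm. 1 and Thm. 3, pp. 315–316] -/
theorem finite_fixedPoints_kerCyclotomicCharacter_two (ht : ∀ x : ℚ, ¬ HasRationalTwoTorsionX W x) :
    Finite (FixedPoints.addSubgroup (GaloisRep.cyclotomicCharacter ℚ 2).toMonoidHom.ker
      (W.geomPrimaryTorsion 2)) := by
  rw [fixedPoints_kerCyclotomicCharacter_geomPrimaryTorsion_eq_bot W ht]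
  infer_instance

end Main

/-! ## §4 The descent step (ε) of road (b″) WITHOUT the Ribet hypothesis -/

section Descent

variable (W : WeierstrassCurve ℚ) [W.IsElliptic] (κ : ZpExtension ℚ 2)

/-- **(ε), unconditional on the seed cell.** For an elliptic `E/ℚ` with no rational point of order `2` and the
cyclotomic `ℤ₂`-extension `ℚ_∞`: the classes of `H¹(ℚ_∞, E[2^∞])` restricting to `0` in `H¹(ℚ(ζ_{2^∞}), E[2^∞])`
form a FINITE set (inflation–restriction along `ker χ₂ ≤ ker κ`, index `2`, with `E(ℚ(ζ_{2^∞}))[2^∞] = 0`) —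
`InfRes.finite_ker_res_kerCyclotomicCharacter` with its Ribet hypothesis DISCHARGED. In particular the RELAXED
restrictions of `…FineRoadInfResRel` §4 have finite kernels, i.e. the descent maps `fd^{rel}`, `fyʳ` of the
netted data have finite cokernels. [cite: GreenbergLNM1716, §3 Lemma 3.1 (the argument)]
[cite: SerreGaloisCohomology1997, I §2.6 (inflation–restriction)] -/
theorem finite_ker_res_kerCyclotomicCharacter_two (ht : ∀ x : ℚ, ¬ HasRationalTwoTorsionX W x)
    (hκ : κ.IsCyclotomic) :
    Set.Finite {c : W.subgroupH1 2 κ.kerSubgroup |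
      W.resOfLe 2 (InfRes.ker_cyclotomicCharacter_le_kerSubgroup κ hκ) c = 0} :=
  InfRes.finite_ker_resOfLe (M := W.geomPrimaryTorsion 2) (InfRes.ker_cyclotomicCharacter_le_kerSubgroup κ hκ)
    (fun g _ h hh ↦ (MonoidHom.normal_ker _).conj_mem' h hh g) (InfRes.finiteIndex_ker_cyclotomicCharacter κ hκ)
    (fun m ↦ W.continuous_smul_geomPrimaryTorsion 2 m) (finite_fixedPoints_kerCyclotomicCharacter_two W ht)

/-- **(ε) on the Selmer group, unconditional on the seed cell**: the kernel of
`Sel_{2^∞}(E/ℚ_∞) → H¹(ℚ(ζ_{2^∞}), E[2^∞])` is finite (no Ribet hypothesis).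
[cite: GreenbergLNM1716, §3 Lemma 3.1 (the argument)] -/
theorem finite_ker_res_selmerInfty_two (ht : ∀ x : ℚ, ¬ HasRationalTwoTorsionX W x) (hκ : κ.IsCyclotomic) :
    Set.Finite {c : W.subgroupH1 2 κ.kerSubgroup | c ∈ W.selmerInfty κ ∧
      W.resOfLe 2 (InfRes.ker_cyclotomicCharacter_le_kerSubgroup κ hκ) c = 0} :=
  (finite_ker_res_kerCyclotomicCharacter_two W κ ht hκ).subset fun _ hc ↦ hc.2

end Descent

end Summit.BirchSwinnertonDyer.BirchSwinnertonDyer.Theorems.AlignedTransportAtTwoFineRoad.CycTorsion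

end
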